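import Summits.ValiantsHypothesis.ValiantsHypothesis.Theorems.LacunarySymmetroidMatrixDescartesCensusChamberLambda

/-!
# `MatrixDescartes` census — the Λ-rule CHAMBER-UNIFORMLY: one-orientation schema, complete rows, first instances

HONEST FRAMING.  Object-search cell `pub-symmetroid`, door-A target `DoorA26 := PosRootLawAt 2 6 19`
(stmt-ValiantsHypothesis-19979; OPEN, typed, never asserted), crux `Theses.LacunarySymmetroid.MatrixDescartes`
(stmt-ValiantsHypothesis-18050).  The kernel lemma `Census.lambda_rule_false` (`…CensusChamberLambda.lean`) read off a
chamber order for SYMBOLIC exponents, exactly like `Census.no_twenty_on_chamber_cell` (parity) and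
`Census.no_twenty_on_chamber_cell_ltri` (L-tri):

* `no_twenty_on_chamber_cell_lambda` — positions of the two definite letters and of fourteen pairs as decidable data,
  nine triangle parities ⇒ no twenty of that orientation on ANY exponent vector of the chamber;
* `posRootLawOn_of_chamber_parity_lambda` — parity cell + Λ-cell ⇒ the door-A row `PosRootLawOn 2 6 19 d` on the chamber;
* the first mirror pair of the 18 atlas-open cells the rule kills: chambers 408 / 609 of theory g6's table (the other 16
  rows are `…CensusChamberLambdaA.lean`).  All 18 have their other cell parity-dead, so each is a COMPLETE chamber row;
  with them 244 of the 2 608 chambers are dead at sign level in both orientations, all in the kernel, and the sign-level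
  atlas has exactly one open mirror pair left (chambers 920 / 1844, word `IIIIII`, no definite letter).

SIGN layer only; nothing on `DoorA26` as a whole (OPEN), the crux, or `VP ≠ VNP`.

[folklore] Bookkeeping over this seat's Λ-rule; no citation exists or is needed.
-/

-- `Summit.ValiantsHypothesis.ValiantsHypothesis.…` repeats a component by the D-0017 layout
-- (single-conjunct summit), which the `dupNamespace` linter flags; the name is mandated.
set_option linter.dupNamespace false

namespace Summit.ValiantsHypothesis.ValiantsHypothesis.Theorems.LacunarySymmetroidMatrixDescartes.Census

open Polynomial Finset
open scoped BigOperators Polynomial Matrix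

/-! ## The chamber-uniform schema -/

/-- **ONE-ORIENTATION CHAMBER-UNIFORM Λ-KILL.**  `σ` lists the 21 pairs in the order of their sums (`σ 0 = (i₀,i₀)`
lowest); `η` encodes the orientation «`(−1)^η det S_{i₀} > 0`» (`sign c_p = (−1)^{p+η}` for a twenty).  Data: definite
letters `P, U` (diagonal positions `aP, aU` of parity `η`), letters `A B C D`, and the positions of the fourteen pairs
`PU PA PB PC PD UA UB UC AB AC BC AD BD CD`, with the nine triangle parities of `Census.lambda_rule_false`
(`(P,U,A)`, `(P,U,B)`, `(P,A,C)`, `(P,B,C)`, `(P,C,D)` odd; `(P,U,C)`, `(P,A,B)`, `(P,A,D)`, `(P,B,D)` even — a triangle is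
odd iff the sum of its three positions plus `η` is odd) — all decidable.  Then on EVERY exponent vector `d` of the chamber
no real symmetric `2 × 2` pencil of that orientation has `20 = D(2,6)` distinct positive det-roots. [folklore] -/
theorem no_twenty_on_chamber_cell_lambda (σ : Fin 21 → Fin 6 × Fin 6) (η : ℕ) (i₀ P U A B K D : Fin 6)
    (aP aU ePU ePA ePB ePC ePD eUA eUB eUC eAB eAC eBC eAD eBD eCD : Fin 21)
    (hcert : (∀ p : Fin 6 × Fin 6, ∃ t : Fin 21, σ t = p ∨ σ t = p.swap) ∧ σ 0 = (i₀, i₀) ∧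
      (P ≠ U ∧ P ≠ A ∧ P ≠ B ∧ P ≠ K ∧ P ≠ D ∧ U ≠ A ∧ U ≠ B ∧ U ≠ K ∧ A ≠ B ∧ A ≠ K ∧ B ≠ K ∧ A ≠ D ∧ B ≠ D ∧
        K ≠ D) ∧
      (σ aP = (P, P) ∧ σ aU = (U, U)) ∧
      ((σ ePU = (P, U) ∨ σ ePU = (U, P)) ∧ (σ ePA = (P, A) ∨ σ ePA = (A, P)) ∧ (σ ePB = (P, B) ∨ σ ePB = (B, P)) ∧
        (σ ePC = (P, K) ∨ σ ePC = (K, P)) ∧ (σ ePD = (P, D) ∨ σ ePD = (D, P)) ∧ (σ eUA = (U, A) ∨ σ eUA = (A, U)) ∧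
        (σ eUB = (U, B) ∨ σ eUB = (B, U)) ∧ (σ eUC = (U, K) ∨ σ eUC = (K, U)) ∧ (σ eAB = (A, B) ∨ σ eAB = (B, A)) ∧
        (σ eAC = (A, K) ∨ σ eAC = (K, A)) ∧ (σ eBC = (B, K) ∨ σ eBC = (K, B)) ∧ (σ eAD = (A, D) ∨ σ eAD = (D, A)) ∧
        (σ eBD = (B, D) ∨ σ eBD = (D, B)) ∧ (σ eCD = (K, D) ∨ σ eCD = (D, K))) ∧
      (Even ((aP : ℕ) + η) ∧ Even ((aU : ℕ) + η)) ∧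
      (Odd ((ePU : ℕ) + ePA + eUA + η) ∧ Odd ((ePU : ℕ) + ePB + eUB + η) ∧ Even ((ePU : ℕ) + ePC + eUC + η) ∧
        Even ((ePA : ℕ) + ePB + eAB + η) ∧ Odd ((ePA : ℕ) + ePC + eAC + η) ∧ Odd ((ePB : ℕ) + ePC + eBC + η) ∧
        Even ((ePA : ℕ) + ePD + eAD + η) ∧ Even ((ePB : ℕ) + ePD + eBD + η) ∧ Odd ((ePC : ℕ) + ePD + eCD + η)))
    (d : Fin 6 → ℕ) (hd : StrictMono ((fun p : Fin 6 × Fin 6 => d p.1 + d p.2) ∘ σ))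
    (S : Fin 6 → Matrix (Fin 2) (Fin 2) ℝ) (hS : ∀ l, (S l).IsSymm)
    (hZ : 20 ≤ ((∑ l, ((X : ℝ[X]) ^ d l) • (S l).map C).det.roots.toFinset.filter (fun t => 0 < t)).card)
    (hs : 0 < (-1 : ℝ) ^ η * (S i₀ 0 0 * S i₀ 1 1 - S i₀ 0 1 ^ 2)) : False := by
  obtain ⟨hcov, h0, ⟨nPU, nPA, nPB, nPC, nPD, nUA, nUB, nUC, nAB, nAC, nBC, nAD, nBD, nCD⟩, ⟨haP, haU⟩,
    ⟨gPU, gPA, gPB, gPC, gPD, gUA, gUB, gUC, gAB, gAC, gBC, gAD, gBD, gCD⟩, ⟨paP, paU⟩,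
    ⟨q1, q2, q3, q4, q5, q6, q7, q8, q9⟩⟩ := hcert
  set Pd := (∑ l, ((X : ℝ[X]) ^ d l) • (S l).map Polynomial.C).det with hP_def
  set W := (Finset.univ : Finset (Fin 6 × Fin 6)).image (fun p => d p.1 + d p.2) with hW_def
  have hN : W.card = 21 := card_pairSums_of_chamber σ hcov d hd
  have memW : ∀ u v : Fin 6, d u + d v ∈ W := fun u v =>
    Finset.mem_image.mpr ⟨(u, v), Finset.mem_univ _, rfl⟩
  have hP : Pd ≠ 0 := by
    intro hP0
    have : (Pd.roots.toFinset.filter (fun t => 0 < t)).card = 0 := by rw [hP0]; simp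
    omega
  have hsupp : Pd.support = W := by
    have hsub : Pd.support ⊆ W := by
      rw [hP_def, hW_def, ← sumset_two_eq_pairSums d]; exact support_det_pencil_subset_sumset d S
    refine Finset.eq_of_subset_of_card_le hsub ?_
    have h := Literature.Computability.AlgebraicComplexity.card_roots_toFinset_filter_pos_lt_card_support hP
    omega
  have hZ' : Pd.support.card ≤ (Pd.roots.toFinset.filter (fun t => 0 < t)).card + 1 := by
    rw [hsupp]; omega
  have F1 : ∀ x y : ℕ, x ∈ W → y ∈ W →
      0 < (-1 : ℝ) ^ ((W.filter (· < x)).card + (W.filter (· < y)).card) * (Pd.coeff x * Pd.coeff y) := by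
    intro x y hx hy
    have := pow_rank_mul_coeff_mul_coeff_pos_of_sharp Pd hZ' (by rw [hsupp]; exact hx) (by rw [hsupp]; exact hy)
    rwa [hsupp] at this
  have hsum : ∀ {t : Fin 21} {u v : Fin 6}, σ t = (u, v) → d u + d v = d (σ t).1 + d (σ t).2 := by
    intro t u v ht; rw [ht]
  have udiag : ∀ {t : Fin 21} {u : Fin 6}, σ t = (u, u) →
      ∀ p : Fin 6 × Fin 6, d p.1 + d p.2 = d u + d u → p = (u, u) := by
    intro t u ht p hp
    rw [hsum ht] at hp
    rcases pair_eq_of_chamber σ hcov d hd t p hp with h | h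
    · rw [h, ht]
    · rw [h, ht]; rfl
  have upair : ∀ {t : Fin 21} {u v : Fin 6}, σ t = (u, v) →
      ∀ p : Fin 6 × Fin 6, d p.1 + d p.2 = d u + d v → p = (u, v) ∨ p = (v, u) := by
    intro t u v ht p hp
    rw [hsum ht] at hp
    rcases pair_eq_of_chamber σ hcov d hd t p hp with h | h
    · left; rw [h, ht]
    · right; rw [h, ht]; rfl
  have rk : ∀ {t : Fin 21} {u v : Fin 6}, σ t = (u, v) → (W.filter (· < d u + d v)).card = t := by
    intro t u v ht
    rw [hsum ht]
    exact card_filter_lt_of_chamber σ hcov d hd t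
  have hsym : ∀ l, S l 1 0 = S l 0 1 := fun l => by
    have h := congrFun (congrFun (hS l) 1) 0
    simp only [Matrix.transpose_apply] at h
    exact h.symm
  have hdiag : ∀ {t : Fin 21} {u : Fin 6}, σ t = (u, u) → Pd.coeff (d u + d u) = S u 0 0 * S u 1 1 - S u 0 1 ^ 2 := by
    intro t u ht; rw [hP_def, coeff_det_pencil_two_diag d S u (udiag ht), hsym, sq]
  have hpair : ∀ {t : Fin 21} {u v : Fin 6}, σ t = (u, v) → u ≠ v →
      Pd.coeff (d u + d v) = S u 0 0 * S v 1 1 + S u 1 1 * S v 0 0 - 2 * (S u 0 1 * S v 0 1) := by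
    intro t u v ht huv; rw [hP_def, coeff_det_pencil_two_pair d S huv (upair ht), hsym, hsym]; ring
  have tw : ∀ x : ℕ, x ∈ W → 0 < (-1 : ℝ) ^ ((W.filter (· < x)).card + η) * Pd.coeff x := by
    intro x hx
    have h1 := F1 (d i₀ + d i₀) x (memW i₀ i₀) hx
    rw [rk h0, hdiag h0] at h1
    simp only [Fin.val_zero, zero_add] at h1
    have h2 : 0 < ((-1 : ℝ) ^ (W.filter (· < x)).card * ((S i₀ 0 0 * S i₀ 1 1 - S i₀ 0 1 ^ 2) * Pd.coeff x)) *
        ((-1 : ℝ) ^ η * (S i₀ 0 0 * S i₀ 1 1 - S i₀ 0 1 ^ 2)) := mul_pos h1 hs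
    have h3 : ((-1 : ℝ) ^ (W.filter (· < x)).card * ((S i₀ 0 0 * S i₀ 1 1 - S i₀ 0 1 ^ 2) * Pd.coeff x)) *
        ((-1 : ℝ) ^ η * (S i₀ 0 0 * S i₀ 1 1 - S i₀ 0 1 ^ 2))
        = ((-1 : ℝ) ^ ((W.filter (· < x)).card + η) * Pd.coeff x) * (S i₀ 0 0 * S i₀ 1 1 - S i₀ 0 1 ^ 2) ^ 2 := by
      rw [pow_add]; ring
    rw [h3] at h2
    exact pos_of_mul_pos_left h2 (sq_nonneg _)
  have hdet : ∀ {t : Fin 21} {u : Fin 6}, σ t = (u, u) → Even ((t : ℕ) + η) → 0 < S u 0 0 * S u 1 1 - S u 0 1 ^ 2 := by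
    intro t u ht hev
    have := tw _ (memW u u)
    rw [rk ht, hev.neg_one_pow, hdiag ht] at this
    linarith
  have hmix : ∀ {t : Fin 21} {u v : Fin 6}, σ t = (u, v) → u ≠ v →
      0 < (-1 : ℝ) ^ ((t : ℕ) + η) * (S u 0 0 * S v 1 1 + S u 1 1 * S v 0 0 - 2 * (S u 0 1 * S v 0 1)) := by
    intro t u v ht huv
    have := tw _ (memW u v)
    rwa [rk ht, hpair ht huv] at this
  have hmix' : ∀ {t : Fin 21} {u v : Fin 6}, (σ t = (u, v) ∨ σ t = (v, u)) → u ≠ v →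
      0 < (-1 : ℝ) ^ ((t : ℕ) + η) * (S u 0 0 * S v 1 1 + S u 1 1 * S v 0 0 - 2 * (S u 0 1 * S v 0 1)) := by
    intro t u v ht huv
    rcases ht with ht | ht
    · exact hmix ht huv
    · have h := hmix ht huv.symm
      have e : S v 0 0 * S u 1 1 + S v 1 1 * S u 0 0 - 2 * (S v 0 1 * S u 0 1)
          = S u 0 0 * S v 1 1 + S u 1 1 * S v 0 0 - 2 * (S u 0 1 * S v 0 1) := by ring
      rwa [e] at h
  have hΔP := hdet haP paP
  have hΔU := hdet haU paU
  have bPU := hmix' gPU nPU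
  have bPA := hmix' gPA nPA
  have bPB := hmix' gPB nPB
  have bPC := hmix' gPC nPC
  have bPD := hmix' gPD nPD
  have bUA := hmix' gUA nUA
  have bUB := hmix' gUB nUB
  have bUC := hmix' gUC nUC
  have bAB := hmix' gAB nAB
  have bAC := hmix' gAC nAC
  have bBC := hmix' gBC nBC
  have bAD := hmix' gAD nAD
  have bBD := hmix' gBD nBD
  have bCD := hmix' gCD nCD
  have twist3 : ∀ {x y z : ℕ}, ((x : ℕ) + η) + ((y : ℕ) + η) + ((z : ℕ) + η) = (x + y + z + η) + 2 * η := by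
    intro x y z; ring
  have od : ∀ {x y z : ℕ}, Odd (x + y + z + η) → Odd ((x + η) + (y + η) + (z + η)) := by
    intro x y z ho; rw [twist3]; exact ho.add_even (even_two_mul η)
  have ev : ∀ {x y z : ℕ}, Even (x + y + z + η) → Even ((x + η) + (y + η) + (z + η)) := by
    intro x y z hev; rw [twist3]; exact hev.add (even_two_mul η)
  have r1 := prod_neg_of_pos_twists_odd bPU bPA bUA (od q1)
  have r2 := prod_neg_of_pos_twists_odd bPU bPB bUB (od q2)
  have r3 := prod_pos_of_pos_twists_even bPU bPC bUC (ev q3)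
  have r4 := prod_pos_of_pos_twists_even bPA bPB bAB (ev q4)
  have r5 := prod_neg_of_pos_twists_odd bPA bPC bAC (od q5)
  have r6 := prod_neg_of_pos_twists_odd bPB bPC bBC (od q6)
  have r7 := prod_pos_of_pos_twists_even bPA bPD bAD (ev q7)
  have r8 := prod_pos_of_pos_twists_even bPB bPD bBD (ev q8)
  have r9 := prod_neg_of_pos_twists_odd bPC bPD bCD (od q9)
  exact lambda_rule_false (S P 0 0) (S P 0 1) (S P 1 1) (S U 0 0) (S U 0 1) (S U 1 1)
    (S A 0 0) (S A 0 1) (S A 1 1) (S B 0 0) (S B 0 1) (S B 1 1) (S K 0 0) (S K 0 1) (S K 1 1)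
    (S D 0 0) (S D 0 1) (S D 1 1) hΔP hΔU r1 r2 r3 r4 r5 r6 r7 r8 r9

/-- **COMPLETE CHAMBER ROW from one parity cell and one Λ-cell.**  A sign-class (odd definite triangle) certificate
for the orientation `η` and a Λ-certificate for the orientation `η + 1` give `ζ(2,6; d) ≤ 19` for EVERY exponent vector
`d` of the chamber of `σ` (via `Census.posRootLawOn_of_chamber_cell`). [folklore] -/
theorem posRootLawOn_of_chamber_parity_lambda (σ : Fin 21 → Fin 6 × Fin 6) (η : ℕ) (i₀ i j k : Fin 6)
    (a b c e f g : Fin 21) (P U A B K D : Fin 6)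
    (aP aU ePU ePA ePB ePC ePD eUA eUB eUC eAB eAC eBC eAD eBD eCD : Fin 21)
    (hcert : (∀ p : Fin 6 × Fin 6, ∃ t : Fin 21, σ t = p ∨ σ t = p.swap) ∧ σ 0 = (i₀, i₀) ∧
      (i ≠ j ∧ j ≠ k ∧ i ≠ k) ∧
      (σ a = (i, i) ∧ σ b = (j, j) ∧ σ c = (k, k) ∧ σ e = (i, j) ∧ σ f = (j, k) ∧ σ g = (i, k)) ∧
      (Even ((a : ℕ) + η) ∧ Even ((b : ℕ) + η) ∧ Even ((c : ℕ) + η) ∧ Odd ((e : ℕ) + f + g + η)))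
    (hcert' : (∀ p : Fin 6 × Fin 6, ∃ t : Fin 21, σ t = p ∨ σ t = p.swap) ∧ σ 0 = (i₀, i₀) ∧
      (P ≠ U ∧ P ≠ A ∧ P ≠ B ∧ P ≠ K ∧ P ≠ D ∧ U ≠ A ∧ U ≠ B ∧ U ≠ K ∧ A ≠ B ∧ A ≠ K ∧ B ≠ K ∧ A ≠ D ∧
        B ≠ D ∧ K ≠ D) ∧
      (σ aP = (P, P) ∧ σ aU = (U, U)) ∧
      ((σ ePU = (P, U) ∨ σ ePU = (U, P)) ∧ (σ ePA = (P, A) ∨ σ ePA = (A, P)) ∧ (σ ePB = (P, B) ∨ σ ePB = (B, P)) ∧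
        (σ ePC = (P, K) ∨ σ ePC = (K, P)) ∧ (σ ePD = (P, D) ∨ σ ePD = (D, P)) ∧
        (σ eUA = (U, A) ∨ σ eUA = (A, U)) ∧ (σ eUB = (U, B) ∨ σ eUB = (B, U)) ∧
        (σ eUC = (U, K) ∨ σ eUC = (K, U)) ∧ (σ eAB = (A, B) ∨ σ eAB = (B, A)) ∧
        (σ eAC = (A, K) ∨ σ eAC = (K, A)) ∧ (σ eBC = (B, K) ∨ σ eBC = (K, B)) ∧
        (σ eAD = (A, D) ∨ σ eAD = (D, A)) ∧ (σ eBD = (B, D) ∨ σ eBD = (D, B)) ∧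
        (σ eCD = (K, D) ∨ σ eCD = (D, K))) ∧
      (Even ((aP : ℕ) + (η + 1)) ∧ Even ((aU : ℕ) + (η + 1))) ∧
      (Odd ((ePU : ℕ) + ePA + eUA + (η + 1)) ∧ Odd ((ePU : ℕ) + ePB + eUB + (η + 1)) ∧
        Even ((ePU : ℕ) + ePC + eUC + (η + 1)) ∧ Even ((ePA : ℕ) + ePB + eAB + (η + 1)) ∧
        Odd ((ePA : ℕ) + ePC + eAC + (η + 1)) ∧ Odd ((ePB : ℕ) + ePC + eBC + (η + 1)) ∧
        Even ((ePA : ℕ) + ePD + eAD + (η + 1)) ∧ Even ((ePB : ℕ) + ePD + eBD + (η + 1)) ∧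
        Odd ((ePC : ℕ) + ePD + eCD + (η + 1))))
    (d : Fin 6 → ℕ) (hd : StrictMono ((fun p : Fin 6 × Fin 6 => d p.1 + d p.2) ∘ σ)) : PosRootLawOn 2 6 19 d :=
  posRootLawOn_of_chamber_cell σ η i₀ i j k a b c e f g hcert d hd
    (fun S hS hZ hs => no_twenty_on_chamber_cell_lambda σ (η + 1) i₀ P U A B K D aP aU ePU ePA ePB ePC ePD eUA eUB
      eUC eAB eAC eBC eAD eBD eCD hcert' d hd S hS hZ hs)

/-! ## First instances: the mirror pair 408 / 609 -/

/-- **Door-A row on the whole chamber 408** of theory g6's table (mirror 609; smallest member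
`(0,12,14,18,23,33)`, words `DIIDDD` / `IDDIII`): the `s = +` cell dies by the odd definite triangle `{0,3,4}`,
the `s = −` cell — open at sign level in the atlas — by the Λ-rule (definite `1`, `2`; letters `4 5 0 3`);
hence `ζ(2,6; d) ≤ 19` for EVERY exponent vector of the chamber. [folklore] -/
theorem doorA26_on_chamber408 (d : Fin 6 → ℕ)
    (hd : StrictMono ((fun p : Fin 6 × Fin 6 => d p.1 + d p.2) ∘
      ![(0, 0), (0, 1), (0, 2), (0, 3), (0, 4), (1, 1), (1, 2), (2, 2), (1, 3), (2, 3), (0, 5),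
        (1, 4), (3, 3), (2, 4), (3, 4), (1, 5), (4, 4), (2, 5), (3, 5), (4, 5), (5, 5)])) :
    PosRootLawOn 2 6 19 d :=
  posRootLawOn_of_chamber_parity_lambda _ 0 0 0 3 4 0 12 16 3 14 4
    1 2 4 5 0 3 5 7 6 11 15 1 8 13 17 2 19 4 10 14 18 3 (by decide)
    (by refine ⟨?_, ?_, ?_, ?_, ?_, ?_, ?_⟩ <;> decide) d hd

/-- **Door-A row on the whole chamber 609** of theory g6's table (mirror 408; smallest member
`(0,10,15,19,21,33)`, words `DDDIID` / `IIIDDI`): the `s = +` cell dies by the odd definite triangle `{0,1,2}`,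
the `s = −` cell — open at sign level in the atlas — by the Λ-rule (definite `3`, `4`; letters `0 1 2 5`);
hence `ζ(2,6; d) ≤ 19` for EVERY exponent vector of the chamber. [folklore] -/
theorem doorA26_on_chamber609 (d : Fin 6 → ℕ)
    (hd : StrictMono ((fun p : Fin 6 × Fin 6 => d p.1 + d p.2) ∘
      ![(0, 0), (0, 1), (0, 2), (0, 3), (1, 1), (0, 4), (1, 2), (1, 3), (2, 2), (1, 4), (0, 5),
        (2, 3), (2, 4), (3, 3), (3, 4), (4, 4), (1, 5), (2, 5), (3, 5), (4, 5), (5, 5)])) :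
    PosRootLawOn 2 6 19 d :=
  posRootLawOn_of_chamber_parity_lambda _ 0 0 0 1 2 0 4 8 1 6 2
    3 4 0 1 2 5 13 15 14 3 7 11 18 5 9 12 1 2 6 10 16 17 (by decide)
    (by refine ⟨?_, ?_, ?_, ?_, ?_, ?_, ?_⟩ <;> decide) d hd

/-- The smallest support of chamber 408, `(0,12,14,18,23,33)`, by the decidable membership test. [folklore] -/
example : PosRootLawOn 2 6 19 (![0, 12, 14, 18, 23, 33] : Fin 6 → ℕ) :=
  doorA26_on_chamber408 _ (Fin.strictMono_iff_lt_succ.2 (by decide))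

end Summit.ValiantsHypothesis.ValiantsHypothesis.Theorems.LacunarySymmetroidMatrixDescartes.Census
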